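import Summits.HodgeConjecture.HodgeConjecture.Theorems.Ring2AbelianAllAndreFibreClassConstancy
import Summits.HodgeConjecture.HodgeConjecture.Theorems.Ring2AbelianAllAndreFibreClassKernelHolds
import HarnessLib

/-!
# Ring 2 · sub-cell AbelianAll (ALL ABELIAN VARIETIES), André axis, part XIII-f — the supply node (φ) is an
# UNCONDITIONAL THEOREM; the André / Lefschetz column has NO supply node and NO named fact left

HONEST FRAMING (page 1, verbatim): **research route, not a corollary; conditional on HC_CM plus one named
minimal statement.** Cell line: research route conditional on HC_CM; not a corollary; Q11.4-sentence-2
already refuted in dim ≥ 3. Nothing in this file proves a case of the Hodge conjecture for an abelian variety.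
Seat `pub-hodge-ring2-ab-andre-2`, gen 5.

With part XIII-e (`fulton1998_map_fundamentalClass_fibre_eq_holds`: the lit seat's named fact
`Fulton1998_map_fundamentalClass_fibre_eq` is PROVED) and part XII-e (`fibreGysinKernelCompactPencils_holds`,
κ), both print-true topological supply nodes of the fibre-class Lefschetz column are tree theorems:

* (φ) `fibreClassConstantCompactPencils_holds` (part XIII-e §4): the fibre class `[𝒳_t] = j_{t*} 1 ∈ H²(𝒳(ℂ); ℂ)`
  of a compact pencil of abelian varieties does not depend on `t`; `fibreClass_supplyNodes_hold : κ ∧ φ`.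

Hence every row of parts X-b/X-e/XII-e that carried `(hφ : FibreClassConstantCompactPencils)` loses it
(names with a trailing `''`):

* **`fibreClassLefschetzOnCompactPencils_of_hodgeConjecture'' : HodgeConjecture → (β∀′)`** — the repaired
  fibre-class Lefschetz node on EVERY compact pencil of abelian varieties is a CASE OF THE SUMMIT with no supply
  node and no named fact (RING2-MAP N14: `HC ⟹ (β∀′)` is now **K**, fact-free); (β′) on CM-pointed pencils,
  `(β′)_d` for every `d`, and `(β∃′)` modulo André's Lemme 6.3.1 (which supplies the CM-anchored pencil);
* **`fibreClassLefschetzOnAtRelDim_one_holds : FibreClassLefschetzOnAtRelDim 1`** — UNCONDITIONAL: on every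
  compact pencil of elliptic curves the cup product with the fibre class has an ALGEBRAIC quasi-inverse
  (part XI `fibreClassLefschetzOnAtRelDim_one_of_const`: κ in the extreme degrees is elementary and the
  quasi-inverse is built from the fibre class itself — no Hodge-conjecture input);
* the graded rows `(β′)_d ⟸ HC^d(squares)` and the `HC_CM`-free Weil rows
  `(W_E)₃ ∧ HC⁶(squares of the rel-dim-6 pencils) ⟹ WeilSixfolds / NonsplitSixfolds`,
  `(∀ n ≥ 2, (W_E)ₙ ∧ HC^{2n}(squares)) ⟹ WeilClassesImaginaryQuadratic` (R∞) — with NO topological hypothesis.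

Everything is proved; 0 `sorry`; no new definitions; no named fact in the closure of any row except where a
binder says so (`h₂₁ = andre1996_cmAnchoredPencil` in the (β∃′) row).

## References

* [Fulton1998] W. Fulton, Intersection Theory, 2nd ed., Springer 1998, §19.1 Prop. 19.1.1.
* [Abdulali1994FamiliesAV] S. Abdulali, Algebraic cycles in families of abelian varieties, Canad. J. Math. 46
  (1994), Conjecture 5.3, Remark 5.4 (p. 1130).
* [Andre1996Motifs] Y. André, Pour une théorie inconditionnelle des motifs, Publ. Math. IHÉS 83 (1996), §6.3
  Lemme 6.3.1, Remarque 2 (pp. 31–33).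
* [Weil1977HodgeRing] A. Weil, Abelian varieties and the Hodge ring, Œuvres III [1977c].
-/

noncomputable section

set_option linter.dupNamespace false

namespace Summit.HodgeConjecture.HodgeConjecture.Ring2.AbelianAll

open CategoryTheory AlgebraicGeometry MonoidalCategory
open Literature.AlgebraicGeometry Literature.AlgebraicGeometry.Motives
open Literature.AlgebraicGeometry.HodgeTheory
open Literature.AlgebraicGeometry.Andre1996 (andre1996_cmAnchoredPencil)
open Summit.HodgeConjecture.HodgeConjecture
open Summit.HodgeConjecture.HodgeConjecture.Theses
open Summit.HodgeConjecture.HodgeConjecture.WeilTypeLadder (WeilClassesImaginaryQuadratic NonsplitSixfolds)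

variable {𝒳 S : SchemeOver ℂ}

/-! ## §1 (κ) and (φ) are theorems -/

/-- AUDIT: both supply nodes (κ), (φ) of the fibre-class Lefschetz column hold unconditionally. [folklore] -/
theorem fibreClass_supplyNodes_hold : FibreGysinKernelCompactPencils ∧ FibreClassConstantCompactPencils :=
  ⟨fibreGysinKernelCompactPencils_holds, fibreClassConstantCompactPencils_holds⟩

/-! ## §2 The on-path rows with NO supply node: `HodgeConjecture ⟹ (β∀′)` fact-free -/

/-- **`HodgeConjecture → (β∀′)` — the repaired fibre-class Lefschetz node on every compact pencil of abelian
varieties is a CASE OF THE SUMMIT, with no supply node and no named fact** (part X-b's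
`fibreClassLefschetzOnCompactPencils_of_hodgeConjecture` with κ and φ discharged).
[cite: Andre1996Motifs, §6.3 Remarque 2 (p. 33)] [cite: Abdulali1994FamiliesAV, Conjecture 5.3 (p. 1130)] -/
theorem fibreClassLefschetzOnCompactPencils_of_hodgeConjecture'' (h : _root_.HodgeConjecture) :
    FibreClassLefschetzOnCompactPencils :=
  fibreClassLefschetzOnCompactPencils_of_hodgeConjecture fibreGysinKernelCompactPencils_holds
    fibreClassConstantCompactPencils_holds h

/-- `HodgeConjecture → (β′)` on the CM-pointed compact pencils, fact-free. [cite: Andre1996Motifs, §6.3 Remarque 2 (p. 33)] -/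
theorem fibreClassLefschetzOnCMPointedPencils_of_hodgeConjecture'' (h : _root_.HodgeConjecture) :
    FibreClassLefschetzOnCMPointedPencils :=
  fibreClassLefschetzOnCMPointedPencils_of_hodgeConjecture fibreGysinKernelCompactPencils_holds
    fibreClassConstantCompactPencils_holds h

/-- `HodgeConjecture → (β′)_d` for every relative dimension `d`, fact-free.
[cite: Andre1996Motifs, §6.3 Remarque 2 (p. 33)] -/
theorem fibreClassLefschetzOnAtRelDim_of_hodgeConjecture'' (h : _root_.HodgeConjecture) (d : ℕ) :
    FibreClassLefschetzOnAtRelDim d :=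
  fibreClassLefschetzOnAtRelDim_of_hodgeConjecture fibreGysinKernelCompactPencils_holds
    fibreClassConstantCompactPencils_holds h d

/-- `HodgeConjecture → (β∃′)` modulo André's Lemme 6.3.1 only (the lemma supplies the CM-anchored compact pencil
through the given abelian variety). [cite: Andre1996Motifs, Lemme 6.3.1 (p. 31) and Remarque 2 (p. 33)] -/
theorem cmAnchoredPencilFibreClassLefschetzOn_of_hodgeConjecture'' (h₂₁ : andre1996_cmAnchoredPencil)
    (h : _root_.HodgeConjecture) : CMAnchoredPencilFibreClassLefschetzOn :=
  cmAnchoredPencilFibreClassLefschetzOn_of_hodgeConjecture h₂₁ fibreGysinKernelCompactPencils_holds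
    fibreClassConstantCompactPencils_holds h

/-- Under `HodgeConjecture`, the full fibre-class package: κ, φ, (β∀′ᵖᵗ) and (β∀′). [cite: Andre1996Motifs, §6.3 Remarque 2 (p. 33)] -/
theorem fibreClassPackage_of_hodgeConjecture (h : _root_.HodgeConjecture) :
    FibreGysinKernelCompactPencils ∧ FibreClassConstantCompactPencils ∧
      FibreClassLefschetzPointwiseCompactPencils ∧ FibreClassLefschetzOnCompactPencils :=
  ⟨fibreGysinKernelCompactPencils_holds, fibreClassConstantCompactPencils_holds,
    fibreClassLefschetzPointwiseCompactPencils_of_hodgeConjecture' h,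
    fibreClassLefschetzOnCompactPencils_of_hodgeConjecture'' h⟩

/-! ## §3 Unconditional and graded rows -/

/-- **`(β′)_1` HOLDS UNCONDITIONALLY**: on every compact pencil of elliptic curves (relative dimension `1`), for
`p ≤ 1`, there is an ALGEBRAIC correspondence `T` of the total surface with `j_s^* ∘ T ∘ j_{t*} ∘ j_t^* = j_s^*` —
part XI's `fibreClassLefschetzOnAtRelDim_one_of_const` (κ in the extreme degrees is elementary, the quasi-inverse
is built from the fibre class) fed with the discharged (φ). No Hodge-conjecture input, no named fact.
[cite: Abdulali1994FamiliesAV, Conjecture 5.3 (p. 1130)] [cite: Fulton1998, §19.1 Prop. 19.1.1] -/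
theorem fibreClassLefschetzOnAtRelDim_one_holds : FibreClassLefschetzOnAtRelDim 1 :=
  fibreClassLefschetzOnAtRelDim_one_of_const fibreClassConstantCompactPencils_holds

/-- **`(β′)_d ⟸ HC^d` of the squares of the total spaces** (codimension-`d` rational `(d,d)`-classes on
`𝒳 × 𝒳` algebraic, for the rel-dim-`d` compact abelian pencils) — no topological hypothesis left.
[cite: Abdulali1994FamiliesAV, Conjecture 5.3 (p. 1130)] -/
theorem fibreClassLefschetzOnAtRelDim_of_codim'' (d : ℕ)
    (halg : ∀ ⦃𝒳 S : SchemeOver ℂ⦄ ⦃f : 𝒳 ⟶ S⦄, IsCompactAbelianPencil f d →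
      ∀ c : complexBetti (𝒳 ⊗ 𝒳) (2 * d), IsRationalClass c →
        IsOfHodgeType ((d + 1) + (d + 1)) (𝒳 ⊗ 𝒳) (2 * d) d d c → c ∈ algebraicClasses (𝒳 ⊗ 𝒳) d) :
    FibreClassLefschetzOnAtRelDim d :=
  fibreClassLefschetzOnAtRelDim_of_codim' d fibreClassConstantCompactPencils_holds halg

/-- (β′_f) on one compact pencil from codimension-`d` Hodge classes on `𝒳 × 𝒳` alone.
[cite: Abdulali1994FamiliesAV, Conjecture 5.3 (p. 1130)] -/
theorem fibreClassLefschetzOn_of_codim'' {d : ℕ} {f : 𝒳 ⟶ S} (hf : IsCompactAbelianPencil f d)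
    (halg : ∀ c : complexBetti (𝒳 ⊗ 𝒳) (2 * d), IsRationalClass c →
      IsOfHodgeType ((d + 1) + (d + 1)) (𝒳 ⊗ 𝒳) (2 * d) d d c → c ∈ algebraicClasses (𝒳 ⊗ 𝒳) d) :
    FibreClassLefschetzOn hf :=
  fibreClassLefschetzOn_of_codim' hf (fibreClassConstantOn_holds hf) halg

/-! ## §4 The `HC_CM`-free Weil rows with NO topological hypothesis -/

/-- **`(W_E)₃ ∧ HC⁶(the 14-fold squares of the rel-dim-6 compact abelian pencils) ⟹ WeilSixfolds`** (item
stmt-HodgeConjecture-2524 as a target): the smallest open instance of the column, now with EVERY topological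
input discharged — no `HC_CM`, no κ, no φ, no named fact. research route, not a corollary; conditional on HC_CM
plus one named minimal statement. [cite: Andre1996Motifs, §6.3 Remarque 2 (p. 33)] [cite: Weil1977HodgeRing] -/
theorem weilSixfolds_of_cmPowerWeilPencilsAt_of_codimSix'' (hW : CMPowerAnchoredCompactWeilPencilsAt 3)
    (halg : ∀ ⦃𝒳 S : SchemeOver ℂ⦄ ⦃f : 𝒳 ⟶ S⦄, IsCompactAbelianPencil f 6 →
      ∀ c : complexBetti (𝒳 ⊗ 𝒳) (2 * 6), IsRationalClass c →
        IsOfHodgeType ((6 + 1) + (6 + 1)) (𝒳 ⊗ 𝒳) (2 * 6) 6 6 c → c ∈ algebraicClasses (𝒳 ⊗ 𝒳) 6) :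
    Theses.SevenfoldWeilCensus.WeilSixfolds :=
  weilSixfolds_of_cmPowerWeilPencilsAt_of_codimSix' hW fibreClassConstantCompactPencils_holds halg

/-- The same for the NON-SPLIT sixfolds (hweil's rung R1′). [cite: Andre1996Motifs, §6.3 Remarque 2 (p. 33)] -/
theorem nonsplitSixfolds_of_cmPowerWeilPencilsAt_of_codimSix'' (hW : CMPowerAnchoredCompactWeilPencilsAt 3)
    (halg : ∀ ⦃𝒳 S : SchemeOver ℂ⦄ ⦃f : 𝒳 ⟶ S⦄, IsCompactAbelianPencil f 6 →
      ∀ c : complexBetti (𝒳 ⊗ 𝒳) (2 * 6), IsRationalClass c →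
        IsOfHodgeType ((6 + 1) + (6 + 1)) (𝒳 ⊗ 𝒳) (2 * 6) 6 6 c → c ∈ algebraicClasses (𝒳 ⊗ 𝒳) 6) :
    NonsplitSixfolds :=
  nonsplitSixfolds_of_cmPowerWeilPencilsAt_of_codimSix' hW fibreClassConstantCompactPencils_holds halg

/-- **Weil's question (R∞), all `n ≥ 2`**: `(∀ n ≥ 2, (W_E)ₙ) ∧ (∀ n ≥ 2, HC^{2n} of the squares) ⟹
WeilClassesImaginaryQuadratic` — no `HC_CM`, no topological hypothesis, no named fact. [cite: Weil1977HodgeRing]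
[cite: Abdulali1994FamiliesAV, Conjecture 5.3 (p. 1130)] -/
theorem weilClassesImaginaryQuadratic_of_cmPowerWeilPencils_of_codim''
    (hW : ∀ n, 2 ≤ n → CMPowerAnchoredCompactWeilPencilsAt n)
    (halg : ∀ n, 2 ≤ n → ∀ ⦃𝒳 S : SchemeOver ℂ⦄ ⦃f : 𝒳 ⟶ S⦄, IsCompactAbelianPencil f (2 * n) →
      ∀ c : complexBetti (𝒳 ⊗ 𝒳) (2 * (2 * n)), IsRationalClass c →
        IsOfHodgeType ((2 * n + 1) + (2 * n + 1)) (𝒳 ⊗ 𝒳) (2 * (2 * n)) (2 * n) (2 * n) c →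
          c ∈ algebraicClasses (𝒳 ⊗ 𝒳) (2 * n)) :
    WeilClassesImaginaryQuadratic :=
  weilClassesImaginaryQuadratic_of_cmPowerWeilPencils_of_codim' hW fibreClassConstantCompactPencils_holds halg

end Summit.HodgeConjecture.HodgeConjecture.Ring2.AbelianAll

end
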